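import Literature.AlgebraicGeometry.Modules.RelativeAffineStrata
import Literature.AlgebraicGeometry.Modules.ModuleCechStrataBaseChange
import HarnessLib

/-!
# RELATIVE EDITION (ring base `R`) — Base change of the module Čech complex to a prime stratum:
# `Γ(T_𝔭, 𝒪) ⊗_A Č•(𝓥, L) ≅ Č•(g⁻¹𝓥, g^*L)` on `g : P ×_R T_𝔭 ↪ P ×_R T`

RELATIVE EDITION of ★ `Modules/ModuleCechStrataBaseChange` (cell `hodgecm-mathlib`, F-DAG hand (h8-E) «engine of the
relative seesaw», file E2; author B-p08 (g12); port map `B-provers/B-p08/g11/PORTMAP-h8-RelativeSeesaw.B-p08g11.md`): the ★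
file is typed `{K : Type u} [Field K] (P T : SchemeOver K)` and uses the field only through the cartesian square ★
`isPullback_whiskerLeft_snd`, replaced here by the base-general `Motives.isPullback_whiskerLeft_snd_overBase`
(`Modules/RelativeAffineStrata`); the affine base change of sections ★ `exists_linearEquiv_tensor_sections_pullback` /
`map_tensor_sections_pullback_natural` (`Modules/PullbackSectionsBaseChange`), the module Čech complex `SecMod`/`sectionsSystem`/
`cechComplex` (`Modules/ModuleCechComplex`) and the ordered Čech algebra `OrderedCech.*` are base-free and IMPORTED.  Decl for decl
the twin of ★ with `K ↦ R` over the relative strata `Relative.stratum` (namespace `Literature.AlgebraicGeometry.Modules.Relative`):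
`Relative.baseToTotal` · `strataMap` · `strataCover` · `strataMod` · `baseToStratum` · `stratumToTotal` · `baseToStrataTotal` ·
`baseToStratum_apply` · `stratumAlgebra` · `stratumLinearEquiv` · `cechOpen_strataCover(_eq)` · `exists_stratum_tensor_equiv` ·
`strataTensorEquivB(_tmul)` · `strataTensorEquiv(_apply/_natural)` · `strataCechIso` · `module_finite_homology_lTensorSys_quotient`.
Everything is proved; no named facts, no `sorry`.  HC_CM is proved only modulo the 7 printed citations until rung 0 closes; this
file asserts nothing about HC.  Original module docstring (read `K` as `R`):

For `T` affine with ring `A`, `X = P ×_K T`, `ρ = pr_T♯ : A → Γ(X, 𝒪)`, a finite family of AFFINE opens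
`𝓥` of `X` with affine intersections and a finite locally free `L`, and a prime `𝔭` of `A` with stratum
`g : Y = P ×_K T_𝔭 ↪ X` (`Modules/AffineStrata`), the affine base change of sections
(★ `Modules/PullbackSectionsBaseChange.exists_linearEquiv_tensor_sections_pullback`) gives `A`-linear
isomorphisms `B ⊗_A Γ(L, V_s) ≅ Γ(g^*L, g⁻¹V_s)` (`B = Γ(T_𝔭, 𝒪)`, an `A`-algebra through `ι♯`) natural
in non-empty `s`, hence (`Algebra/Homology/OrderedCechSystemMap`: `OrderedCech.sysComplexIsoNE`) an
isomorphism of ordered Čech complexes of `A`-modules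
  `Č(B ⊗_A (s ↦ Γ(L, V_s))) ≅ Č•(g⁻¹𝓥, g^*L)`  (`Modules.strataCechIso`),
together with `B ≃ₗ[A] A⧸𝔭` (`Modules.stratumLinearEquiv`): the input of the quotient step of the
dévissage (`Algebra/Homology/OrderedCechSystemDevissage`: `OrderedCech.StrataFinite`). This is the termwise
computation in the proof of Görtz–Wedhorn II, Prop. 22.90 (flat base change of Čech complexes, here along the
closed stratum after tensoring).

## References

* U. Görtz, T. Wedhorn, *Algebraic Geometry II: Cohomology of Schemes* (2023),
  doi:10.1007/978-3-658-43031-3: Prop. 22.90 (p. 277), proof; Thm. 23.133, proof, Step (I) (p. 354).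
  [GortzWedhorn2023]
* U. Görtz, T. Wedhorn, *Algebraic Geometry I: Schemes*, 2nd ed. (2020), Prop. 7.24 (2), Rem. 7.25.
  [GortzWedhorn2020]
* A. Grothendieck, EGA III₂ (Publ. Math. IHÉS 17, 1963), (6.10.5). [EGA3]
* D. Mumford, *Abelian Varieties*, TIFR Studies in Mathematics 5 (1970), §5. [MumfordAV1970]
-/

set_option autoImplicit false

universe u

open CategoryTheory CategoryTheory.Limits AlgebraicGeometry TopologicalSpace Opposite MonoidalCategory
open CartesianMonoidalCategory TensorProduct
open Literature.AlgebraicGeometry.Motives Literature.Algebra.Homology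

set_option backward.isDefEq.respectTransparency false

noncomputable section

namespace Literature.AlgebraicGeometry.Modules

namespace Relative

variable {R : Type u} [CommRing R] (P T : SchemeOver R) [IsAffine T.left] (𝔭 : PrimeSpectrum Γ(T.left, ⊤))
variable {ι : Type} (𝓥 : ι → (P ⊗ T).left.Opens) (L : (P ⊗ T).left.Modules)

/-! ### Notation for the stratum -/

/-- The structure map `ρ = pr_T♯ : A = Γ(T, 𝒪) → Γ(P ×_R T, 𝒪)` (relative edition of ★ `Modules.baseToTotal`). [folklore] [cite: GortzWedhorn2023, Prop. 22.90 (p. 277), proof] -/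
abbrev baseToTotal (P T : SchemeOver R) : Γ(T.left, ⊤) →+* Γ((P ⊗ T).left, ⊤) := (snd P T).left.appTop.hom

/-- The closed immersion `g : P ×_R T_𝔭 ⟶ P ×_R T` (relative edition of ★ `Modules.strataMap`). [folklore] [cite: GortzWedhorn2023, Prop. 22.90 (p. 277), proof] -/
abbrev strataMap : (P ⊗ Relative.stratum T 𝔭).left ⟶ (P ⊗ T).left := (P ◁ Relative.stratumι T 𝔭).left

/-- The pulled-back family of opens `g⁻¹𝓥` (relative edition of ★ `Modules.strataCover`). [folklore] [cite: GortzWedhorn2023, Prop. 22.90 (p. 277), proof] -/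
abbrev strataCover : ι → (P ⊗ Relative.stratum T 𝔭).left.Opens := fun i => Relative.strataMap P T 𝔭 ⁻¹ᵁ 𝓥 i

/-- The pulled-back module `g^*L` (relative edition of ★ `Modules.strataMod`). [folklore] [cite: GortzWedhorn2023, Prop. 22.90 (p. 277), proof] -/
abbrev strataMod : (P ⊗ Relative.stratum T 𝔭).left.Modules :=
  (Scheme.Modules.pullback (Relative.strataMap P T 𝔭)).obj L

/-- `ι♯ : A → B = Γ(T_𝔭, 𝒪)` in the `appLE ⊤ ⊤` form used by the base-change lemma (relative edition of ★ `Modules.baseToStratum`). [folklore] [cite: GortzWedhorn2023, Prop. 22.90 (p. 277), proof] -/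
abbrev baseToStratum : Γ(T.left, ⊤) →+* Γ((Relative.stratum T 𝔭).left, ⊤) :=
  ((Relative.stratumι T 𝔭).left.appLE ⊤ ⊤ le_top).hom

/-- `pr_{T_𝔭}♯ : B → Γ(P ×_R T_𝔭, 𝒪)` (relative edition of ★ `Modules.stratumToTotal`). [folklore] [cite: GortzWedhorn2023, Prop. 22.90 (p. 277), proof] -/
abbrev stratumToTotal : Γ((Relative.stratum T 𝔭).left, ⊤) →+* Γ((P ⊗ Relative.stratum T 𝔭).left, ⊤) :=
  (snd P (Relative.stratum T 𝔭)).left.appTop.hom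

/-- The structure map `A → Γ(P ×_R T_𝔭, 𝒪)` through `B` (relative edition of ★ `Modules.baseToStrataTotal`). [folklore] [cite: GortzWedhorn2023, Prop. 22.90 (p. 277), proof] -/
abbrev baseToStrataTotal : Γ(T.left, ⊤) →+* Γ((P ⊗ Relative.stratum T 𝔭).left, ⊤) :=
  (Relative.stratumToTotal P T 𝔭).comp (Relative.baseToStratum T 𝔭)

/-- `ι♯` in the two forms agree (`appLE ⊤ ⊤ _ = appTop`). [folklore] [cite: GortzWedhorn2023, Prop. 22.90 (p. 277), proof] -/
theorem baseToStratum_apply (a : Γ(T.left, ⊤)) :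
    Relative.baseToStratum T 𝔭 a = (Relative.stratumι T 𝔭).left.appTop a := by
  change ((Relative.stratumι T 𝔭).left.appLE ⊤ ⊤ le_top) a = _
  rw [Scheme.Hom.appTop, Scheme.Hom.app_eq_appLE]
  rfl

/-! ### `B = Γ(T_𝔭, 𝒪)` as an `A`-module; `B ≃ₗ[A] A⧸𝔭` -/

/-- The `A`-algebra structure on `B = Γ(T_𝔭, 𝒪)` through `ι♯` (a reducible `def`, used with `letI`; relative edition of ★ `Modules.stratumAlgebra`). [folklore] [cite: GortzWedhorn2023, Prop. 22.90 (p. 277), proof] -/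
@[reducible] def stratumAlgebra : Algebra Γ(T.left, ⊤) Γ((Relative.stratum T 𝔭).left, ⊤) :=
  (Relative.baseToStratum T 𝔭).toAlgebra

/-- **`Γ(T_𝔭, 𝒪) ≃ₗ[A] A⧸𝔭`** (the ring isomorphism `Scheme.ΓSpecIso`, `A`-linear because
`ι♯ a ↦ a mod 𝔭`; relative edition of ★ `Modules.stratumLinearEquiv`). [folklore] [cite: GortzWedhorn2023, Prop. 22.90 (p. 277), proof] -/
def stratumLinearEquiv :
    letI := Relative.stratumAlgebra T 𝔭
    Γ((Relative.stratum T 𝔭).left, ⊤) ≃ₗ[Γ(T.left, ⊤)] (Γ(T.left, ⊤) ⧸ 𝔭.asIdeal) :=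
  letI := Relative.stratumAlgebra T 𝔭
  { (Relative.stratumRingIso T 𝔭).commRingCatIsoToRingEquiv.toAddEquiv with
    map_smul' := fun a x => by
      change (Relative.stratumRingIso T 𝔭).hom (Relative.baseToStratum T 𝔭 a * x) =
        Ideal.Quotient.mk 𝔭.asIdeal a * (Relative.stratumRingIso T 𝔭).hom x
      rw [map_mul, baseToStratum_apply, Relative.stratumRingIso_hom_appTop] }

/-! ### The termwise base change on non-empty members -/

section Termwise

variable [LinearOrder ι]
variable (hV : ∀ s : Finset ι, s.Nonempty → IsAffineOpen (cechOpen 𝓥 s)) (hL : IsFiniteLocallyFree L)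

omit [LinearOrder ι] in
/-- `g⁻¹(V_s) = (g⁻¹𝓥)_s`. [folklore] [cite: GortzWedhorn2023, Prop. 22.90 (p. 277), proof] -/
theorem cechOpen_strataCover (s : Finset ι) :
    cechOpen (Relative.strataCover P T 𝔭 𝓥) s = Relative.strataMap P T 𝔭 ⁻¹ᵁ cechOpen 𝓥 s :=
  (preimage_cechOpen 𝓥 (Relative.strataMap P T 𝔭) s).symm

omit [LinearOrder ι] in
/-- The equation `U_Y = g⁻¹U_X ∩ pr⁻¹⊤` of the base-change lemma for the `V_s`. [folklore] [cite: GortzWedhorn2023, Prop. 22.90 (p. 277), proof] -/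
theorem cechOpen_strataCover_eq (s : Finset ι) :
    cechOpen (Relative.strataCover P T 𝔭 𝓥) s =
      Relative.strataMap P T 𝔭 ⁻¹ᵁ cechOpen 𝓥 s ⊓ (snd P (Relative.stratum T 𝔭)).left ⁻¹ᵁ ⊤ := by
  rw [cechOpen_strataCover, Scheme.Hom.preimage_top, inf_top_eq]

include hV hL in
omit [LinearOrder ι] in
/-- **`B ⊗_A Γ(L, V_s) ≃ₗ[B] Γ(g^*L, g⁻¹V_s)`, `b ⊗ m ↦ b · η(m)|`** (★ `exists_linearEquiv_tensor_sections_pullback` for the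
cartesian square over `T_𝔭 ↪ T`, `Motives.isPullback_whiskerLeft_snd_overBase`), with the module structures of
`Modules/ModuleCechComplex` (`SecMod`); relative edition of ★ `Modules.exists_stratum_tensor_equiv`.
[cite: GortzWedhorn2020, Prop. 7.24 (2) and Rem. 7.25] -/
theorem exists_stratum_tensor_equiv (s : Finset ι) (hs : s.Nonempty) :
    letI := Relative.stratumAlgebra T 𝔭
    ∃ e : Γ((Relative.stratum T 𝔭).left, ⊤) ⊗[Γ(T.left, ⊤)] SecMod L (Relative.baseToTotal P T) (cechOpen 𝓥 s)
        ≃ₗ[Γ((Relative.stratum T 𝔭).left, ⊤)]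
        SecMod (Relative.strataMod P T 𝔭 L) (Relative.stratumToTotal P T 𝔭) (cechOpen (Relative.strataCover P T 𝔭 𝓥) s),
      ∀ (b : Γ((Relative.stratum T 𝔭).left, ⊤)) (m : SecMod L (Relative.baseToTotal P T) (cechOpen 𝓥 s)),
        e (b ⊗ₜ m) = b • SecMod.mk (unitSectionLE (Relative.strataMap P T 𝔭) L
          (le_preimage_left_of_eq_inf (Relative.cechOpen_strataCover_eq P T 𝔭 𝓥 s)) (SecMod.val m)) := by
  letI := Relative.stratumAlgebra T 𝔭
  letI : Module Γ(T.left, ⊤) Γ(L, cechOpen 𝓥 s) := SecMod.instModule L (Relative.baseToTotal P T) (cechOpen 𝓥 s)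
  letI : Module Γ((Relative.stratum T 𝔭).left, ⊤) Γ(Relative.strataMod P T 𝔭 L, cechOpen (Relative.strataCover P T 𝔭 𝓥) s) :=
    SecMod.instModule (Relative.strataMod P T 𝔭 L) (Relative.stratumToTotal P T 𝔭)
      (cechOpen (Relative.strataCover P T 𝔭 𝓥) s)
  haveI := hL.isVectorBundle.1
  exact exists_linearEquiv_tensor_sections_pullback (isPullback_whiskerLeft_snd_overBase P (Relative.stratumι T 𝔭))
    (isAffineOpen_top T.left) (isAffineOpen_top (Relative.stratum T 𝔭).left) (hV s hs) le_top
    (fun x _ => trivial) (Relative.cechOpen_strataCover_eq P T 𝔭 𝓥 s) L (IsAffineLocalizing.of_isQuasicoherent L)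
    rfl (fun r m => rfl) (fun t n => rfl)

end Termwise

/-! ### The `A`-linear base-change isomorphisms and their naturality -/

section Assembly

variable [LinearOrder ι]
variable (hV : ∀ s : Finset ι, s.Nonempty → IsAffineOpen (cechOpen 𝓥 s)) (hL : IsFiniteLocallyFree L)

/-- The `B`-linear base change `B ⊗_A Γ(L, V_s) ≃ₗ[B] Γ(g^*L, g⁻¹V_s)` on a non-empty `s` (a choice
of the isomorphism of `exists_stratum_tensor_equiv`; relative edition of ★ `Modules.strataTensorEquivB`). [cite: GortzWedhorn2020, Prop. 7.24 (2)] -/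
def strataTensorEquivB (s : Finset ι) (hs : s.Nonempty) :
    letI := Relative.stratumAlgebra T 𝔭
    Γ((Relative.stratum T 𝔭).left, ⊤) ⊗[Γ(T.left, ⊤)] SecMod L (Relative.baseToTotal P T) (cechOpen 𝓥 s)
      ≃ₗ[Γ((Relative.stratum T 𝔭).left, ⊤)]
      SecMod (Relative.strataMod P T 𝔭 L) (Relative.stratumToTotal P T 𝔭) (cechOpen (Relative.strataCover P T 𝔭 𝓥) s) :=
  letI := Relative.stratumAlgebra T 𝔭
  Classical.choose (Relative.exists_stratum_tensor_equiv P T 𝔭 𝓥 L hV hL s hs)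

omit [LinearOrder ι] in
/-- The `B`-linear base change on pure tensors: `b ⊗ m ↦ b · η(m)|`. [folklore] [cite: GortzWedhorn2023, Prop. 22.90 (p. 277), proof] -/
theorem strataTensorEquivB_tmul (s : Finset ι) (hs : s.Nonempty)
    (b : Γ((Relative.stratum T 𝔭).left, ⊤)) (m : SecMod L (Relative.baseToTotal P T) (cechOpen 𝓥 s)) :
    letI := Relative.stratumAlgebra T 𝔭
    Relative.strataTensorEquivB P T 𝔭 𝓥 L hV hL s hs (b ⊗ₜ m) =
      b • SecMod.mk (ρ := Relative.stratumToTotal P T 𝔭) (unitSectionLE (Relative.strataMap P T 𝔭) L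
        (le_preimage_left_of_eq_inf (Relative.cechOpen_strataCover_eq P T 𝔭 𝓥 s)) (SecMod.val m)) :=
  Classical.choose_spec (Relative.exists_stratum_tensor_equiv P T 𝔭 𝓥 L hV hL s hs) b m

/-- **The `A`-linear base change `B ⊗_A Γ(L, V_s) ≃ₗ[A] Γ(g^*L, g⁻¹V_s)`** on a non-empty `s` (the
`B`-linear isomorphism `strataTensorEquivB` with scalars restricted along `ι♯ : A → B`; the target
carries the `A`-module structure through `A → B → Γ(P ×_R T_𝔭, 𝒪)`; relative edition of ★ `Modules.strataTensorEquiv`).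
[cite: GortzWedhorn2020, Prop. 7.24 (2)] -/
def strataTensorEquiv (s : Finset ι) (hs : s.Nonempty) :
    letI := Relative.stratumAlgebra T 𝔭
    Γ((Relative.stratum T 𝔭).left, ⊤) ⊗[Γ(T.left, ⊤)] SecMod L (Relative.baseToTotal P T) (cechOpen 𝓥 s)
      ≃ₗ[Γ(T.left, ⊤)]
      SecMod (Relative.strataMod P T 𝔭 L) (Relative.baseToStrataTotal P T 𝔭) (cechOpen (Relative.strataCover P T 𝔭 𝓥) s) :=
  letI := Relative.stratumAlgebra T 𝔭
  let e := Relative.strataTensorEquivB P T 𝔭 𝓥 L hV hL s hs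
  { toFun := e
    invFun := e.symm
    map_add' := e.map_add
    left_inv := e.left_inv
    right_inv := e.right_inv
    map_smul' := fun a x => by
      rw [← IsScalarTower.algebraMap_smul (Γ((Relative.stratum T 𝔭).left, ⊤)) a x, LinearEquiv.map_smul]
      rfl }

omit [LinearOrder ι] in
/-- The `A`-linear and the `B`-linear base changes have the same underlying map. [folklore] [cite: GortzWedhorn2023, Prop. 22.90 (p. 277), proof] -/
theorem strataTensorEquiv_apply (s : Finset ι) (hs : s.Nonempty)
    (x : letI := Relative.stratumAlgebra T 𝔭
      Γ((Relative.stratum T 𝔭).left, ⊤) ⊗[Γ(T.left, ⊤)] SecMod L (Relative.baseToTotal P T) (cechOpen 𝓥 s)) :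
    Relative.strataTensorEquiv P T 𝔭 𝓥 L hV hL s hs x = Relative.strataTensorEquivB P T 𝔭 𝓥 L hV hL s hs x := rfl

omit [LinearOrder ι] in
/-- **Naturality of the base change in the open** (`s ⊆ t` non-empty): restriction after base change is
base change after `1 ⊗ res` (★ `map_tensor_sections_pullback_natural`; relative edition of ★ `Modules.strataTensorEquiv_natural`).
[cite: GortzWedhorn2020, Prop. 7.24 (2) and Rem. 7.25] -/
theorem strataTensorEquiv_natural (s t : Finset ι) (hs : s.Nonempty) (ht : t.Nonempty) (h : s ⊆ t)
    (x : letI := Relative.stratumAlgebra T 𝔭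
      Γ((Relative.stratum T 𝔭).left, ⊤) ⊗[Γ(T.left, ⊤)] SecMod L (Relative.baseToTotal P T) (cechOpen 𝓥 s)) :
    letI := Relative.stratumAlgebra T 𝔭
    Relative.strataTensorEquiv P T 𝔭 𝓥 L hV hL t ht
        (((OrderedCech.lTensorSys Γ((Relative.stratum T 𝔭).left, ⊤)
          (sectionsSystem 𝓥 L (Relative.baseToTotal P T))).map (homOfLE h)).hom x) =
      ((sectionsSystem (Relative.strataCover P T 𝔭 𝓥) (Relative.strataMod P T 𝔭 L)
        (Relative.baseToStrataTotal P T 𝔭)).map (homOfLE h)).hom (Relative.strataTensorEquiv P T 𝔭 𝓥 L hV hL s hs x) := by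
  letI := Relative.stratumAlgebra T 𝔭
  letI : Module Γ(T.left, ⊤) Γ(L, cechOpen 𝓥 s) := SecMod.instModule L (Relative.baseToTotal P T) (cechOpen 𝓥 s)
  letI : Module Γ(T.left, ⊤) Γ(L, cechOpen 𝓥 t) := SecMod.instModule L (Relative.baseToTotal P T) (cechOpen 𝓥 t)
  letI : Module Γ((Relative.stratum T 𝔭).left, ⊤)
      Γ(Relative.strataMod P T 𝔭 L, cechOpen (Relative.strataCover P T 𝔭 𝓥) s) :=
    SecMod.instModule (Relative.strataMod P T 𝔭 L) (Relative.stratumToTotal P T 𝔭)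
      (cechOpen (Relative.strataCover P T 𝔭 𝓥) s)
  letI : Module Γ((Relative.stratum T 𝔭).left, ⊤)
      Γ(Relative.strataMod P T 𝔭 L, cechOpen (Relative.strataCover P T 𝔭 𝓥) t) :=
    SecMod.instModule (Relative.strataMod P T 𝔭 L) (Relative.stratumToTotal P T 𝔭)
      (cechOpen (Relative.strataCover P T 𝔭 𝓥) t)
  have key := map_tensor_sections_pullback_natural (iY := (snd P (Relative.stratum T 𝔭)).left)
    (Relative.cechOpen_strataCover_eq P T 𝔭 𝓥 s) (Relative.cechOpen_strataCover_eq P T 𝔭 𝓥 t) (cechOpen_anti 𝓥 h)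
    L (fun _ _ => rfl) (fun _ _ => rfl)
    (SecMod.res L (Relative.baseToTotal P T) (cechOpen_anti 𝓥 h)) (fun _ => rfl)
    (Relative.strataTensorEquivB P T 𝔭 𝓥 L hV hL s hs).toLinearMap
    (Relative.strataTensorEquivB_tmul P T 𝔭 𝓥 L hV hL s hs)
    (Relative.strataTensorEquivB P T 𝔭 𝓥 L hV hL t ht).toLinearMap
    (Relative.strataTensorEquivB_tmul P T 𝔭 𝓥 L hV hL t ht) x
  exact key.symm

/-- **The base change of the module Čech complex to the stratum**: an isomorphism of ordered Čech
complexes of `A`-modules `Č(B ⊗_A (s ↦ Γ(L, V_s))) ≅ Č•(g⁻¹𝓥, g^*L)` (`OrderedCech.sysComplexIsoNE` on the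
termwise base changes; EGA III 6.10.5 / Görtz–Wedhorn II, proof of Prop. 22.90; relative edition of ★ `Modules.strataCechIso`).
[cite: GortzWedhorn2023, Prop. 22.90 (p. 277), proof] -/
def strataCechIso :
    letI := Relative.stratumAlgebra T 𝔭
    OrderedCech.sysComplex (OrderedCech.lTensorSys Γ((Relative.stratum T 𝔭).left, ⊤)
        (sectionsSystem 𝓥 L (Relative.baseToTotal P T))) ≅
      cechComplex (Relative.strataCover P T 𝔭 𝓥) (Relative.strataMod P T 𝔭 L) (Relative.baseToStrataTotal P T 𝔭) :=
  letI := Relative.stratumAlgebra T 𝔭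
  OrderedCech.sysComplexIsoNE (fun s hs => Relative.strataTensorEquiv P T 𝔭 𝓥 L hV hL s hs)
    (fun s t hs ht h x => Relative.strataTensorEquiv_natural P T 𝔭 𝓥 L hV hL s t hs ht h x)

include hV hL in
/-- **The quotient step of the dévissage, geometric form**: if the module Čech cohomology of `g^*L` on
the (integral) stratum `P ×_R T_𝔭` is finitely generated over `A`, then so is that of the system
`A⧸𝔭 ⊗_A (s ↦ Γ(L, V_s))` (relative edition of ★ `Modules.module_finite_homology_lTensorSys_quotient`).
[cite: GortzWedhorn2023, Thm. 23.133, proof, Step (I) (p. 354)] -/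
theorem module_finite_homology_lTensorSys_quotient
    (hfin : ∀ i, Module.Finite Γ(T.left, ⊤)
      ((cechComplex (Relative.strataCover P T 𝔭 𝓥) (Relative.strataMod P T 𝔭 L)
        (Relative.baseToStrataTotal P T 𝔭)).homology i))
    (i : ℤ) :
    Module.Finite Γ(T.left, ⊤) ((OrderedCech.sysComplex
      (OrderedCech.lTensorSys (Γ(T.left, ⊤) ⧸ 𝔭.asIdeal) (sectionsSystem 𝓥 L (Relative.baseToTotal P T)))).homology i) := by
  letI := Relative.stratumAlgebra T 𝔭
  have h₁ := OrderedCech.module_finite_homology_of_iso (Relative.strataCechIso P T 𝔭 𝓥 L hV hL).symm i (hfin i)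
  exact OrderedCech.module_finite_homology_of_iso
    (OrderedCech.sysComplexMapIso (OrderedCech.lTensorSysIso (sectionsSystem 𝓥 L (Relative.baseToTotal P T))
      (Relative.stratumLinearEquiv T 𝔭))) i h₁

end Assembly

end Relative

end Literature.AlgebraicGeometry.Modules

end
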